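import Summits.Ventures.PercRepro.RLSRuleTriangleSupply

/-!
# C-025 at q = 3: the triangle plane — the loss-free supply (night-3, gen 4)

**`triangle_supply_free`** — no line charged (`Λ = ∅`, the case `t ≥ 2` where no witness is coplanar with a line):
`17T₀ + 51T₁ + 51T₂ + W ≤ Σ_{S ∈ Yq} w⁺(G, S)` in the unit witness sums.
Imports `RLSRuleTriangleSupply`.  Axioms: standard.
-/

open scoped Matroid

namespace PercRepro

namespace NightThree

open Finset ThmH PerFlat

variable {α : Type*} [DecidableEq α] {M : Matroid α} [M.Finite]

open scoped Classical in
/-- **The profile accounting of the triangle plane, no loss** (`Λ = ∅`). -/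
theorem triangle_supply_free {p : ℕ} (hc : Core M p) {G K : Finset α} {L : Finset (Finset α)} {n : ℕ}
    (hG : G ∈ flatsQ M 3) (h : Triangle M G L) (hKsub : K ⊆ gr M \ G) (hKind : M.Indep (K : Set α))
    (hemp : ∀ ℓ ∈ L, coplanarTriples M ℓ K = ∅) :
    17 * (∑ X ∈ witnessFamily K n, 1 / (((3 + X.card).choose 3 : ℕ) : ℚ))
    + 51 * (∑ X ∈ witnessFamily K n, 1 / (((4 + X.card).choose 3 : ℕ) : ℚ))
    + 51 * (∑ X ∈ witnessFamily K n, 1 / (((5 + X.card).choose 3 : ℕ) : ℚ))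
    + (∑ _X ∈ witnessFamily K n, (1 : ℚ))
    ≤ ∑ S ∈ Yq M (n + 4) 3, wPlus M G S := by
  obtain ⟨hmem3, h𝔅rank, hd34, hd5, hd6, hc3, hc4, hc5⟩ := triangle_family hc hG h
  have hdep := depTriples_eq_of_triangle h
  have h' := h
  obtain ⟨hGc, hLc, hL, hdeg, hdeg2, hind⟩ := h
  have hsup := supply_ge_profile hc hG hKsub hKind n (∅ : Finset (Finset α))
    (fun ℓ hℓ _ => by rw [hdep] at hℓ; exact hemp ℓ hℓ) (fun _ => ∅)
    (fun ℓ hℓ => absurd hℓ (Finset.notMem_empty ℓ)) h𝔅rank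
  refine le_trans ?_ hsup
  have hval : ∀ B X, (if ∀ ℓ ∈ (∅ : Finset (Finset α)), ℓ ⊆ B → ¬ (fun _ => (∅ : Finset α)) ℓ ⊆ X then
      profileShare M B X else 0) = profileShare M B X := by
    intro B X
    rw [if_pos (fun ℓ hℓ => absurd hℓ (Finset.notMem_empty ℓ))]
  simp only [hval]
  have hshare : ∀ B, B ⊆ G → 3 ≤ B.card → B.card ≤ 5 → ∀ X,
      profileShare M B X = ((B.card.choose 3 - (L.filter (fun ℓ => ℓ ⊆ B)).card : ℕ) : ℚ) /
        (((B.card + X.card).choose 3 : ℕ) : ℚ) := by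
    intro B hB _ hB5 X
    unfold profileShare
    rw [if_pos hB5]
    congr 1
    have := rho3_eq_of_triangle h' hB
    exact_mod_cast (by omega : rho3 M B = B.card.choose 3 - (L.filter (fun ℓ => ℓ ⊆ B)).card)
  have h3 : ∑ B ∈ (G.powersetCard 3).filter (fun T => T ∉ L), ∑ X ∈ witnessFamily K n, profileShare M B X =
      17 * (∑ X ∈ witnessFamily K n, 1 / (((3 + X.card).choose 3 : ℕ) : ℚ)) := by
    have hv : ∀ B ∈ (G.powersetCard 3).filter (fun T => T ∉ L), ∑ X ∈ witnessFamily K n, profileShare M B X =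
        ∑ X ∈ witnessFamily K n, 1 / (((3 + X.card).choose 3 : ℕ) : ℚ) := by
      intro B hB
      obtain ⟨hBG, hBc, hnl, _⟩ := hmem3 B hB
      have hj : (L.filter (fun ℓ => ℓ ⊆ B)).card = 0 := by
        rw [Finset.card_eq_zero, Finset.filter_eq_empty_iff]; exact hnl
      apply Finset.sum_congr rfl
      intro X _
      rw [hshare B hBG (by omega) (by omega) X, hj, hBc]
      simp
    rw [Finset.sum_congr rfl hv, Finset.sum_const, hc3, nsmul_eq_mul]; norm_num
  have h4 : ∑ B ∈ G.powersetCard 4, ∑ X ∈ witnessFamily K n, profileShare M B X =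
      9 * (3 * ∑ X ∈ witnessFamily K n, 1 / (((4 + X.card).choose 3 : ℕ) : ℚ))
      + 6 * (4 * ∑ X ∈ witnessFamily K n, 1 / (((4 + X.card).choose 3 : ℕ) : ℚ)) := by
    have hv : ∀ B ∈ G.powersetCard 4, ∑ X ∈ witnessFamily K n, profileShare M B X =
        (if ∃ ℓ ∈ L, ℓ ⊆ B then 3 * ∑ X ∈ witnessFamily K n, 1 / (((4 + X.card).choose 3 : ℕ) : ℚ)
          else 4 * ∑ X ∈ witnessFamily K n, 1 / (((4 + X.card).choose 3 : ℕ) : ℚ)) := by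
      intro B hB
      obtain ⟨hBG, hBc⟩ := Finset.mem_powersetCard.1 hB
      have hj1 := lines_subset_four_triangle hc hG h' hBG hBc
      by_cases hex : ∃ ℓ ∈ L, ℓ ⊆ B
      · rw [if_pos hex]
        have hj : (L.filter (fun ℓ => ℓ ⊆ B)).card = 1 := by
          obtain ⟨ℓ, hℓ, hl⟩ := hex
          have : 0 < (L.filter (fun ℓ => ℓ ⊆ B)).card := Finset.card_pos.2 ⟨ℓ, Finset.mem_filter.2 ⟨hℓ, hl⟩⟩
          omega
        rw [Finset.mul_sum]; apply Finset.sum_congr rfl; intro X _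
        rw [hshare B hBG (by omega) (by omega) X, hj, hBc, show Nat.choose 4 3 = 4 by norm_num [Nat.choose]]
        norm_num [div_eq_mul_inv]
      · rw [if_neg hex]
        have hj : (L.filter (fun ℓ => ℓ ⊆ B)).card = 0 := by
          rw [Finset.card_eq_zero, Finset.filter_eq_empty_iff]
          intro ℓ hℓ hl; exact hex ⟨ℓ, hℓ, hl⟩
        rw [Finset.mul_sum]; apply Finset.sum_congr rfl; intro X _
        rw [hshare B hBG (by omega) (by omega) X, hj, hBc, show Nat.choose 4 3 = 4 by norm_num [Nat.choose]]
        norm_num [div_eq_mul_inv]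
    rw [Finset.sum_congr rfl hv, ← Finset.sum_filter_add_sum_filter_not (G.powersetCard 4) (fun B => ∃ ℓ ∈ L, ℓ ⊆ B),
      Finset.sum_congr rfl (fun B hB => if_pos (Finset.mem_filter.1 hB).2),
      Finset.sum_congr rfl (fun B hB => if_neg (Finset.mem_filter.1 hB).2),
      Finset.sum_const, Finset.sum_const, card_lined_four_triangle hc hG h']
    have hrest : ((G.powersetCard 4).filter (fun B => ¬ ∃ ℓ ∈ L, ℓ ⊆ B)).card = 6 := by
      have := Finset.card_filter_add_card_filter_not (s := G.powersetCard 4) (fun B => ∃ ℓ ∈ L, ℓ ⊆ B)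
      rw [card_lined_four_triangle hc hG h', hc4] at this
      omega
    rw [hrest]
    simp only [nsmul_eq_mul]
    push_cast
    ring
  have h5 : ∑ B ∈ G.powersetCard 5, ∑ X ∈ witnessFamily K n, profileShare M B X =
      3 * (9 * ∑ X ∈ witnessFamily K n, 1 / (((5 + X.card).choose 3 : ℕ) : ℚ))
      + 3 * (8 * ∑ X ∈ witnessFamily K n, 1 / (((5 + X.card).choose 3 : ℕ) : ℚ)) := by
    rw [sum_powersetCard_five hGc (fun B => ∑ X ∈ witnessFamily K n, profileShare M B X)]
    have hv : ∀ v ∈ G, ∑ X ∈ witnessFamily K n, profileShare M (G.erase v) X =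
        (if (L.filter (fun ℓ => v ∈ ℓ)).card = 2
          then 9 * ∑ X ∈ witnessFamily K n, 1 / (((5 + X.card).choose 3 : ℕ) : ℚ)
          else 8 * ∑ X ∈ witnessFamily K n, 1 / (((5 + X.card).choose 3 : ℕ) : ℚ)) := by
      intro v hv
      have hBc : (G.erase v).card = 5 := by rw [Finset.card_erase_of_mem hv, hGc]
      have hj := card_lines_in_erase (fun ℓ hℓ => (hL ℓ hℓ).1) (G := G) (L := L) (v := v)
      rw [hLc] at hj
      rcases hdeg v hv with h1 | h2
      · rw [if_neg (by omega)]
        have hj2 : (L.filter (fun ℓ => ℓ ⊆ G.erase v)).card = 2 := by omega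
        rw [Finset.mul_sum]; apply Finset.sum_congr rfl; intro X _
        rw [hshare (G.erase v) (Finset.erase_subset v G) (by omega) (by omega) X, hj2, hBc,
          show Nat.choose 5 3 = 10 by norm_num [Nat.choose]]
        norm_num [div_eq_mul_inv]
      · rw [if_pos h2]
        have hj1 : (L.filter (fun ℓ => ℓ ⊆ G.erase v)).card = 1 := by omega
        rw [Finset.mul_sum]; apply Finset.sum_congr rfl; intro X _
        rw [hshare (G.erase v) (Finset.erase_subset v G) (by omega) (by omega) X, hj1, hBc,
          show Nat.choose 5 3 = 10 by norm_num [Nat.choose]]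
        norm_num [div_eq_mul_inv]
    rw [Finset.sum_congr rfl hv,
      ← Finset.sum_filter_add_sum_filter_not G (fun v => (L.filter (fun ℓ => v ∈ ℓ)).card = 2),
      Finset.sum_congr rfl (fun v hv => if_pos (Finset.mem_filter.1 hv).2),
      Finset.sum_congr rfl (fun v hv => if_neg (Finset.mem_filter.1 hv).2),
      Finset.sum_const, Finset.sum_const, hdeg2]
    have hrest : (G.filter (fun v => ¬ (L.filter (fun ℓ => v ∈ ℓ)).card = 2)).card = 3 := by
      have := Finset.card_filter_add_card_filter_not (s := G) (fun v => (L.filter (fun ℓ => v ∈ ℓ)).card = 2)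
      rw [hdeg2, hGc] at this
      omega
    rw [hrest]
    simp only [nsmul_eq_mul]
    push_cast
    ring
  have h6 : ∑ X ∈ witnessFamily K n, profileShare M G X = ∑ _X ∈ witnessFamily K n, (1 : ℚ) := by
    apply Finset.sum_congr rfl; intro X _; unfold profileShare; rw [if_neg (by omega)]
  rw [Finset.sum_union hd6, Finset.sum_union hd5, Finset.sum_union hd34, Finset.sum_singleton, h3, h4, h5, h6]
  linarith

end NightThree

end PercRepro
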